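import Summits.Ventures.DiscreteObjects.PP12.FlagTenShape
import Summits.Ventures.DiscreteObjects.PP12.FlagInscribed

/-!
# The `f = 10` flag-cell orbit data READ OFF a plane: definitions and well-definedness (kernel; Step B of the FlagTenOrbitReduction roadmap)
Framing: lottery ticket; floor = certified bounds/negative ranges.

Cell pub-namedobj (venture DiscreteObjects), target (M), designs gen 13 (HOME FAMILY-FLAG7X §7, Step B). Setting: flag-type collineation `σ`
(`σ³ = 1`) of a projective plane of order 12 with exactly 10 fixed points; `u₀ ∋ c` a non-fixed line. The orbit data of `FlagTenOrbitData`
(designs g12, p322607) are, before transport to `Fin` types: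
* triangles ↔ the points `x ≠ c` of `u₀` (`FlagTenShape.exterior_orbit_meets_cline`); the SIDE `sideOf x = x·σx`;
* `gammaOrb m x` = the orbit of the point `sideOf x ∩ m` on the fixed line `m ≠ l` (∈ the four orbits on `m`, `gammaOrb_mem`);
* `cOrb y x` = the orbit of the line `x·y` through the fixed point `y ≠ c` (∈ the four line orbits through `y`, `cOrb_mem`);
* `betaOrb m B` = the orbit on `m` met by the lines of a line orbit `B` through `y` (independent of the line chosen, `betaOrb_eq`);
* `foreignSide x` = the unique exterior line through `x` other than its two own sides (`FlagSideCensus.existsUnique_foreign_side`) and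
  `phiVertex x` = the vertex on `u₀` of the triangle owning it (`phiVertex_spec`: it is a point `≠ c` of `u₀`, the foreign side is a side of
  its triangle, and that triangle is not the triangle of `x` — `φ i ≠ i`).
All definitions are total (junk values off the hypotheses) with `_spec` lemmas under the flag hypotheses. Steps C/D (the ten conjuncts of
`IsFlagTenOrbitMatrix` for the transported data) remain. No `sorry`, no new axioms.
-/

namespace Summit.Ventures.DiscreteObjects.PP12

open Configuration Finset
open scoped Classical

namespace Collineation

variable {P L : Type*} [Membership P L] [ProjectivePlane P L] [Fintype P] [Fintype L] (σ : Collineation P L)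

/-- The line through `x` and `σx` (the SIDE of the orbit-triangle of `x` through `x, σx`); junk value if `x` is fixed. -/
noncomputable def sideOf (l : L) (x : P) : L := if h : x ≠ σ.onPoints x then HasLines.mkLine h else l

/-- The line through two points; junk value `l` if they coincide. -/
noncomputable def lineThrough (l : L) (x y : P) : L := if h : x ≠ y then HasLines.mkLine h else l

/-- The common point of two lines; junk value `c` if they coincide. -/
noncomputable def meetPt (c : P) (a m : L) : P := if h : a ≠ m then HasPoints.mkPoint h else c

omit [Fintype P] [Fintype L] in
/-- `sideOf` passes through `x` and `σx` when `x` is not fixed. -/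
theorem sideOf_spec (l : L) {x : P} (hx : σ.onPoints x ≠ x) : x ∈ σ.sideOf l x ∧ σ.onPoints x ∈ σ.sideOf l x := by
  unfold sideOf; rw [dif_pos hx.symm]; exact HasLines.mkLine_ax hx.symm

omit [Fintype P] [Fintype L] in
/-- `lineThrough` passes through both points when they differ. -/
theorem lineThrough_spec (l : L) {x y : P} (hxy : x ≠ y) : x ∈ lineThrough l x y ∧ y ∈ lineThrough l x y := by
  unfold lineThrough; rw [dif_pos hxy]; exact HasLines.mkLine_ax hxy

omit [Fintype P] [Fintype L] in
/-- `meetPt` lies on both lines when they differ. -/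
theorem meetPt_spec (c : P) {a m : L} (ham : a ≠ m) : meetPt c a m ∈ a ∧ meetPt c a m ∈ m := by
  unfold meetPt; rw [dif_pos ham]; exact HasPoints.mkPoint_ax ham

omit [Fintype P] [Fintype L] in
/-- uniqueness form of `meetPt` -/
theorem meetPt_eq (c : P) {a m : L} (ham : a ≠ m) {p : P} (hpa : p ∈ a) (hpm : p ∈ m) : p = meetPt c a m :=
  (Nondegenerate.eq_or_eq hpa (meetPt_spec c ham).1 hpm (meetPt_spec c ham).2).resolve_right ham

section Flag

variable {l : L} {c : P} (hl : σ.onLines l = l) (hc : σ.onPoints c = c) (hcl : c ∈ l)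
  (hP : ∀ p : P, σ.onPoints p = p → p ∈ l) (hL : ∀ m : L, σ.onLines m = m → c ∈ m)

omit [Fintype P] [Fintype L] in
include hL in
/-- A point `x ≠ c` of a non-fixed line `u₀ ∋ c` is EXTERIOR (on no fixed line): a fixed line through `x` would contain `c` too. -/
theorem exterior_of_mem_cline {u₀ : L} (hcu₀ : c ∈ u₀) (hu₀ : σ.onLines u₀ ≠ u₀) {x : P} (hxu : x ∈ u₀) (hxc : x ≠ c) :
    ∀ m : L, σ.onLines m = m → x ∉ m := fun m hm hxm =>
  hu₀ (((Nondegenerate.eq_or_eq hxm (hL m hm) hxu hcu₀).resolve_left hxc) ▸ hm)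

/-! ### `γ`: the orbit on a fixed line met by a side -/

/-- `gammaOrb m x` = orbit of the point where the side `x·σx` meets the line `m`. -/
noncomputable def gammaOrb (l : L) (c : P) (m : L) (x : P) : Finset P := orb3 σ.onPoints (meetPt c (σ.sideOf l x) m)

omit [Fintype L] in
include hl hc hP hL in
/-- For an exterior point `x` and a fixed line `m`, `gammaOrb m x` is one of the orbits of the points `≠ c` of `m`
(the index set of `card_orbits_on_fixedLine_eq_four`); the meeting point is the only common point of the side and `m`. -/
theorem gammaOrb_mem {x : P} (hxX : ∀ m : L, σ.onLines m = m → x ∉ m) {m : L} (hm : σ.onLines m = m) :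
    σ.gammaOrb l c m x ∈ (univ.filter fun p : P => p ∈ m ∧ p ≠ c).image (orb3 σ.onPoints) ∧
    meetPt c (σ.sideOf l x) m ∈ σ.sideOf l x ∧ meetPt c (σ.sideOf l x) m ∈ m ∧ σ.onPoints (meetPt c (σ.sideOf l x) m) ≠ meetPt c (σ.sideOf l x) m := by
  have hx : σ.onPoints x ≠ x := σ.not_fixed_of_exterior_flag hl hP hxX
  obtain ⟨hxa, hσxa⟩ := σ.sideOf_spec l hx
  have ha0 : ∀ p : P, σ.onPoints p = p → p ∉ σ.sideOf l x := (σ.side_no_fixed_point hx hxX hxa hσxa).2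
  obtain ⟨w, hwa, hwm, hwf, hwc, huniq⟩ := σ.nofixed_inter_fixedLine hc hL ha0 hm
  have ham : σ.sideOf l x ≠ m := fun e => ha0 c hc (e ▸ hL m hm)
  have hw : w = meetPt c (σ.sideOf l x) m := meetPt_eq c ham hwa hwm
  subst hw
  refine ⟨mem_image.2 ⟨_, mem_filter.2 ⟨mem_univ _, hwm, hwc⟩, rfl⟩, hwa, hwm, hwf⟩

/-! ### `C`: the orbit of the line joining a vertex to a fixed point -/

/-- `cOrb y x` = orbit of the line `x·y`. -/
noncomputable def cOrb (l : L) (y x : P) : Finset L := orb3 σ.onLines (lineThrough l x y)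

omit [Fintype P] in
include hl hP in
/-- For an exterior `x` and a fixed point `y`, `cOrb y x` is one of the line orbits `≠ l` through `y`. -/
theorem cOrb_mem {x : P} (hxX : ∀ m : L, σ.onLines m = m → x ∉ m) {y : P} (hy : σ.onPoints y = y) :
    σ.cOrb l y x ∈ (univ.filter fun m : L => y ∈ m ∧ m ≠ l).image (orb3 σ.onLines) ∧
    x ∈ lineThrough l x y ∧ y ∈ lineThrough l x y := by
  have hx : σ.onPoints x ≠ x := σ.not_fixed_of_exterior_flag hl hP hxX
  have hxy : x ≠ y := fun e => hx (by rw [e, hy])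
  obtain ⟨hxb, hyb⟩ := lineThrough_spec l hxy
  have hbl : lineThrough l x y ≠ l := fun e => hxX l hl (e ▸ hxb)
  exact ⟨mem_image.2 ⟨_, mem_filter.2 ⟨mem_univ _, hyb, hbl⟩, rfl⟩, hxb, hyb⟩

/-! ### `β`: the orbit on `m` met by a line orbit through `y` -/

/-- `betaOrb m B` = orbit on `m` of the meeting point of (a chosen line of) `B` with `m`; junk if `B = ∅`. -/
noncomputable def betaOrb (c : P) (m : L) (B : Finset L) : Finset P :=
  if h : B.Nonempty then orb3 σ.onPoints (meetPt c h.choose m) else ∅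

omit [Fintype P] [Fintype L] in
/-- The orbit on a fixed line `m` met by the lines of the orbit of `b` does not depend on the line: `orb3 (σb ∩ m) = orb3 (b ∩ m)`. -/
theorem orb3_meetPt_map (hq : σ.onPoints ^ 3 = 1) {m : L} (hm : σ.onLines m = m) {b : L} (hbm : b ≠ m) :
    orb3 σ.onPoints (meetPt c (σ.onLines b) m) = orb3 σ.onPoints (meetPt c b m) := by
  have hσbm : σ.onLines b ≠ m := fun e => hbm (σ.onLines.injective (e.trans hm.symm))
  obtain ⟨hwb, hwm⟩ := meetPt_spec c hbm
  -- σ w lies on σ b and on m, hence is the meeting point of σ b and m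
  have h1 : σ.onPoints (meetPt c b m) ∈ σ.onLines b := σ.mem_map hwb
  have h2 : σ.onPoints (meetPt c b m) ∈ m := (σ.mem_fixedLine_iff hm _).2 hwm
  rw [← meetPt_eq c hσbm h1 h2]
  exact orb3_eq_of_mem σ.onPoints hq ((mem_orb3 _ _ _).2 (Or.inr (Or.inl rfl)))

include hc hL in
/-- **`β` is well defined:** for a line orbit `B = orb3 b` of a non-fixed line `b` not through `c` and a fixed line `m`,
`betaOrb m B = orb3 (b' ∩ m)` for EVERY `b' ∈ B`. -/
theorem betaOrb_eq (hq : σ.onPoints ^ 3 = 1) {m : L} (hm : σ.onLines m = m) {b : L} (hcb : c ∉ b) {b' : L}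
    (hb' : b' ∈ orb3 σ.onLines b) : σ.betaOrb c m (orb3 σ.onLines b) = orb3 σ.onPoints (meetPt c b' m) := by
  have hqL : σ.onLines ^ 3 = 1 := σ.onLines_pow_eq_one hq
  have hne : (orb3 σ.onLines b).Nonempty := ⟨b, self_mem_orb3 _ _⟩
  unfold betaOrb; rw [dif_pos hne]
  -- any two lines of the orbit give the same orbit on m
  have hcσ : ∀ e : L, c ∉ e → c ∉ σ.onLines e := fun e he h => he ((σ.mem_iff c e).1 (by rw [hc]; exact h))
  have key : ∀ e ∈ orb3 σ.onLines b, orb3 σ.onPoints (meetPt c e m) = orb3 σ.onPoints (meetPt c b m) := by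
    intro e he; rw [mem_orb3] at he
    have hbm : b ≠ m := fun e' => hcb (e' ▸ hL m hm)
    have hσbm : σ.onLines b ≠ m := fun e' => hcσ b hcb (e' ▸ hL m hm)
    rcases he with rfl | rfl | rfl
    · rfl
    · exact σ.orb3_meetPt_map hq hm hbm
    · rw [σ.orb3_meetPt_map hq hm hσbm, σ.orb3_meetPt_map hq hm hbm]
  rw [key _ hne.choose_spec, key _ hb']

/-! ### `φ`: the foreign side and the triangle owning it -/

/-- The foreign side of `x`: the exterior line through `x` other than its two own sides (junk `l` if there is none). -/
noncomputable def foreignSide (l : L) (x : P) : L :=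
  if h : ∃ f : L, x ∈ f ∧ (∀ p : P, σ.onPoints p = p → p ∉ f) ∧ σ.onPoints x ∉ f ∧ σ.onPoints (σ.onPoints x) ∉ f then h.choose else l

/-- The vertex on `u₀` of the triangle owning the line `f` (a point `x' ≠ c` of `u₀` with `Q, σQ ∈ f` for some `Q ∈ orb3 x'`); junk `c`. -/
noncomputable def ownerVertex (c : P) (u₀ f : L) : P :=
  if h : ∃ x' : P, x' ∈ u₀ ∧ x' ≠ c ∧ ∃ Q ∈ orb3 σ.onPoints x', Q ∈ f ∧ σ.onPoints Q ∈ f then h.choose else c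

/-- `φ` at plane level: the vertex on `u₀` of the triangle in which the triangle of `x` is inscribed. -/
noncomputable def phiVertex (l : L) (c : P) (u₀ : L) (x : P) : P := σ.ownerVertex c u₀ (σ.foreignSide l x)

variable (h12 : ProjectivePlane.order P L = 12)

include hl hP h12 in
/-- The foreign side of an exterior point (`f = 10`) has the defining properties. -/
theorem foreignSide_spec (hq : σ.onPoints ^ 3 = 1) (hf : fixedCard σ.onPoints = 10) {x : P} (hxX : ∀ m : L, σ.onLines m = m → x ∉ m) :
    x ∈ σ.foreignSide l x ∧ (∀ p : P, σ.onPoints p = p → p ∉ σ.foreignSide l x) ∧ σ.onPoints x ∉ σ.foreignSide l x ∧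
      σ.onPoints (σ.onPoints x) ∉ σ.foreignSide l x := by
  obtain ⟨f, hf', -⟩ := σ.existsUnique_foreign_side hl hP h12 hq hf hxX
  have hex : ∃ f : L, x ∈ f ∧ (∀ p : P, σ.onPoints p = p → p ∉ f) ∧ σ.onPoints x ∉ f ∧ σ.onPoints (σ.onPoints x) ∉ f := ⟨f, hf'⟩
  unfold foreignSide; rw [dif_pos hex]; exact hex.choose_spec

include hl hc hcl hP hL h12 in
/-- **`φ` is well defined and moves every triangle** (`f = 10`): for an exterior `x` and a non-fixed `u₀ ∋ c`, `phiVertex x` is a point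
`≠ c` of `u₀`, the foreign side of `x` is a side of the triangle `orb3 (phiVertex x)`, and that triangle is not the triangle of `x`. -/
theorem phiVertex_spec (hq : σ.onPoints ^ 3 = 1) (hf : fixedCard σ.onPoints = 10) {u₀ : L} (hcu₀ : c ∈ u₀) (hu₀ : σ.onLines u₀ ≠ u₀)
    {x : P} (hxX : ∀ m : L, σ.onLines m = m → x ∉ m) :
    σ.phiVertex l c u₀ x ∈ u₀ ∧ σ.phiVertex l c u₀ x ≠ c ∧
      (∃ Q ∈ orb3 σ.onPoints (σ.phiVertex l c u₀ x), Q ∈ σ.foreignSide l x ∧ σ.onPoints Q ∈ σ.foreignSide l x) ∧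
      orb3 σ.onPoints (σ.phiVertex l c u₀ x) ≠ orb3 σ.onPoints x := by
  obtain ⟨hxf, hf0, h1, h2⟩ := σ.foreignSide_spec hl hP h12 hq hf hxX
  obtain ⟨Q, hQ, hQf, hσQf, hne⟩ := σ.foreign_side_owner hl hc hcl hP hL hq hxX hxf hf0 h1 h2
  obtain ⟨x', hx'Q, hx'u⟩ := σ.exterior_orbit_meets_cline hl hc hcl hL h12 hq hf hcu₀ hu₀ hQ.2
  have hx'c : x' ≠ c := by
    intro e
    -- c is fixed but x' ∈ orb3 Q consists of non-fixed points
    have hQ' : σ.onPoints x' ≠ x' := by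
      rw [mem_orb3] at hx'Q
      rcases hx'Q with rfl | rfl | rfl
      · exact hQ.1
      · exact fun e' => hQ.1 (σ.onPoints.injective e')
      · exact fun e' => hQ.1 (σ.onPoints.injective (σ.onPoints.injective e'))
    exact hQ' (by rw [e, hc])
  have horb : orb3 σ.onPoints x' = orb3 σ.onPoints Q := orb3_eq_of_mem σ.onPoints hq hx'Q
  have hex : ∃ x'' : P, x'' ∈ u₀ ∧ x'' ≠ c ∧ ∃ Q' ∈ orb3 σ.onPoints x'', Q' ∈ σ.foreignSide l x ∧ σ.onPoints Q' ∈ σ.foreignSide l x :=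
    ⟨x', hx'u, hx'c, Q, by rw [horb]; exact self_mem_orb3 _ _, hQf, hσQf⟩
  have hdef : σ.phiVertex l c u₀ x = hex.choose := by unfold phiVertex ownerVertex; rw [dif_pos hex]
  obtain ⟨hvu, hvc, Q', hQ'v, hQ'f, hσQ'f⟩ := hex.choose_spec
  rw [hdef]
  refine ⟨hvu, hvc, ⟨Q', hQ'v, hQ'f, hσQ'f⟩, ?_⟩
  -- the triangle of the chosen vertex is the triangle of Q (a line is a side of at most one triangle) hence ≠ triangle of x
  have hQ'Q : Q' = Q := σ.side_unique hQ.2 hQf hσQf hQ'f hσQ'f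
  have h1' : orb3 σ.onPoints Q' = orb3 σ.onPoints hex.choose := orb3_eq_of_mem σ.onPoints hq hQ'v
  rw [← h1', hQ'Q]
  exact hne

include hc hcl hP hL in
/-- **`β` is injective** on the line orbits through a fixed point `y ≠ c`: two T-lines `b, b' ∋ y` whose orbits meet the fixed line `m ≠ l` in the
same point orbit lie in the same line orbit (Step C, conjunct 4 of `IsFlagTenOrbitMatrix`, before transport). -/
theorem betaOrb_injective (hq : σ.onPoints ^ 3 = 1) {y : P} (hy : σ.onPoints y = y) (hyc : y ≠ c) {m : L} (hm : σ.onLines m = m)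
    (hml : m ≠ l) {b b' : L} (hyb : y ∈ b) (hbl : b ≠ l) (hyb' : y ∈ b') (hb'l : b' ≠ l)
    (h : σ.betaOrb c m (orb3 σ.onLines b) = σ.betaOrb c m (orb3 σ.onLines b')) : orb3 σ.onLines b' = orb3 σ.onLines b := by
  have hqL : σ.onLines ^ 3 = 1 := σ.onLines_pow_eq_one hq
  have hcb : c ∉ b := σ.c_not_mem_tline hcl hP hy hyc hyb hbl
  have hcb' : c ∉ b' := σ.c_not_mem_tline hcl hP hy hyc hyb' hb'l
  rw [σ.betaOrb_eq hc hL hq hm hcb (self_mem_orb3 _ _), σ.betaOrb_eq hc hL hq hm hcb' (self_mem_orb3 _ _)] at h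
  have hym : y ∉ m := fun hym => hml ((Nondegenerate.eq_or_eq hym (hL m hm) (hP y hy) hcl).resolve_left hyc)
  have hbm : b ≠ m := fun e => hym (e ▸ hyb)
  have hb'm : b' ≠ m := fun e => hym (e ▸ hyb')
  obtain ⟨hwb, hwm⟩ := meetPt_spec c hbm
  obtain ⟨hw'b, hw'm⟩ := meetPt_spec c hb'm
  have hw' : meetPt c b' m ∈ orb3 σ.onPoints (meetPt c b m) := by rw [h]; exact self_mem_orb3 _ _
  exact orb3_eq_of_mem σ.onLines hqL (σ.tline_orbit_of_fixedLine_orbit hy hyb hyb' hwb hwm hw'b hw'm hym hw')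

omit [ProjectivePlane P L] [Fintype P] [Fintype L] in
/-- points of the orbit of an exterior point are exterior -/
theorem exterior_of_mem_orb3 {Q : P} (hQX : ∀ m : L, σ.onLines m = m → Q ∉ m) {z : P} (hz : z ∈ orb3 σ.onPoints Q) :
    ∀ m : L, σ.onLines m = m → z ∉ m := by
  rw [mem_orb3] at hz
  rcases hz with rfl | rfl | rfl
  · exact hQX
  · exact σ.exterior_map hQX
  · exact σ.exterior_map (σ.exterior_map hQX)

include hl hc hcl hP hL h12 in
/-- **`φ` has no 2-cycle** (`f = 10`): if the triangle of `x` is inscribed in the triangle of `x' = phiVertex x`, then the triangle of `x'` is not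
inscribed in the triangle of `x` (`FlagInscribed.not_mutually_inscribed`), i.e. `phiVertex (phiVertex x) ≠ x` (conjunct 1 of `IsFlagTenOrbitMatrix`). -/
theorem phiVertex_no_two_cycle (hq : σ.onPoints ^ 3 = 1) (hf : fixedCard σ.onPoints = 10) {u₀ : L} (hcu₀ : c ∈ u₀) (hu₀ : σ.onLines u₀ ≠ u₀)
    {x : P} (hxu : x ∈ u₀) (hxc : x ≠ c) : σ.phiVertex l c u₀ (σ.phiVertex l c u₀ x) ≠ x := by
  intro h2
  have hxX := σ.exterior_of_mem_cline hL hcu₀ hu₀ hxu hxc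
  obtain ⟨hx'u, hx'c, ⟨Q, hQx', hQf, hσQf⟩, hne⟩ := σ.phiVertex_spec hl hc hcl hP hL h12 hq hf hcu₀ hu₀ hxX
  set x' := σ.phiVertex l c u₀ x with hx'
  have hx'X := σ.exterior_of_mem_cline hL hcu₀ hu₀ hx'u hx'c
  obtain ⟨-, -, ⟨Q'', hQ''v, hQ''f', hσQ''f'⟩, -⟩ := σ.phiVertex_spec hl hc hcl hP hL h12 hq hf hcu₀ hu₀ hx'X
  rw [h2] at hQ''v
  obtain ⟨hxf, -, -, -⟩ := σ.foreignSide_spec hl hP h12 hq hf hxX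
  obtain ⟨hx'f', -, -, -⟩ := σ.foreignSide_spec hl hP h12 hq hf hx'X
  -- ingredients for `not_mutually_inscribed`: Q exterior, a = foreignSide x ∋ Q, σQ, x; x ∉ {Q, σQ}
  have hQX : ∀ m : L, σ.onLines m = m → Q ∉ m := σ.exterior_of_mem_orb3 hx'X hQx'
  have horbQ : orb3 σ.onPoints Q = orb3 σ.onPoints x' := orb3_eq_of_mem σ.onPoints hq hQx'
  have hxQ : x ≠ Q := fun e => hne (by rw [← horbQ, ← e])
  have hxσQ : x ≠ σ.onPoints Q := fun e => hne (by
    rw [← horbQ, e]; exact (orb3_eq_of_mem σ.onPoints hq (apply_mem_orb3 _ hq (self_mem_orb3 _ _))).symm)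
  have h3 := apply_three σ.onPoints hq x
  -- a line b through x and σx containing a point of orb3 x' = orb3 Q: an image of f' = foreignSide x'
  have key : ∀ {b : L}, x ∈ b → σ.onPoints x ∈ b → ∀ z ∈ orb3 σ.onPoints Q, z ∉ b := by
    intro b hxb hσxb z hz
    obtain ⟨k1, k2, k3⟩ := σ.not_mutually_inscribed hQX hQf hσQf hxf hxQ hxσQ hxb hσxb
    rw [mem_orb3] at hz
    rcases hz with rfl | rfl | rfl
    · exact k1
    · exact k2
    · exact k3
  have hx'Q : x' ∈ orb3 σ.onPoints Q := by rw [horbQ]; exact self_mem_orb3 _ _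
  have hσx'Q : σ.onPoints x' ∈ orb3 σ.onPoints Q := apply_mem_orb3 _ hq hx'Q
  have hσσx'Q : σ.onPoints (σ.onPoints x') ∈ orb3 σ.onPoints Q := apply_mem_orb3 _ hq hσx'Q
  rw [mem_orb3] at hQ''v
  rcases hQ''v with e | e | e
  · -- Q'' = x: f' itself passes through x, σx and x'
    rw [e] at hQ''f' hσQ''f'
    exact key hQ''f' hσQ''f' x' hx'Q hx'f'
  · -- Q'' = σx: f' ∋ σx, σ²x; σ²f' ∋ x, σx and σ²x'
    rw [e] at hQ''f' hσQ''f'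
    have h1 : x ∈ σ.onLines (σ.onLines (σ.foreignSide l x')) := by
      have := σ.mem_map (σ.mem_map hQ''f'); rwa [h3] at this
    have h2' : σ.onPoints x ∈ σ.onLines (σ.onLines (σ.foreignSide l x')) := by
      have := σ.mem_map (σ.mem_map hσQ''f'); rw [h3] at this; exact this
    exact key h1 h2' _ hσσx'Q (σ.mem_map (σ.mem_map hx'f'))
  · -- Q'' = σ²x: f' ∋ σ²x, x; σf' ∋ x, σx and σx'
    rw [e] at hQ''f' hσQ''f'
    rw [h3] at hσQ''f'
    have h1 : x ∈ σ.onLines (σ.foreignSide l x') := by have := σ.mem_map hQ''f'; rwa [h3] at this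
    exact key h1 (σ.mem_map hσQ''f') _ hσx'Q (σ.mem_map hx'f')

end Flag

end Collineation

end Summit.Ventures.DiscreteObjects.PP12
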